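import Summits.Ventures.PercRepro.SixFourResidueFourPlaneLineCore
import Summits.Ventures.PercRepro.SixFourResidueFourGenericHolds
import Summits.Ventures.PercRepro.SixFourPLTrace

/-!
# PercRepro — C-025 at `(6,4)`: the plane-line branch (γ) at `t = 4`, part 1 — the plane inventory (p5, gen 10;
lead (nn))

For a plane-line normalisation `D : PLData M G` (p3's `SixFourPLNorm.lean`: a plane `P₀` with a rank-`3` trace `ρ`
whose complement `L = G ∖ P₀` has rank `≤ 2`) with every plane trace of `≤ g − 3` points and `g ≥ 10`:

* every rank-`3` plane trace has nonnegative slack (`slack4_nonneg`: the per-pair inequality `PerPair4` holds for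
  all `3 ≤ p ≤ g − 3` by p3's table `perPair4_of_range` and tail `perPair4_tail_forall`, so
  `cert_plane_of_perPair4` gives `slack4 ≥ (6/5)·Ξ ≥ 0`);
* the plane of a class `C ∈ D.classes` is `PiC C := cl(L ∪ C)` (`PiC_eq_Pi`: it is `Π_y` for every `y ∈ C ∖ ℓ`),
  a plane with a rank-`3` trace, different from `P₀`, and `C ↦ PiC C` is injective (`PiC_injOn`: `C = PiC C ∩ ρ`);
* **`sum_slack4_ge_inventory`** — dropping the nonnegative slacks of the other planes (the `{x} ∪ λ` planes of
  `plane_trichotomy`): `Σ_{P : r(P ∩ G) = 3} slack4(P) ≥ slack4(P₀) + Σ_{C ∈ classes} slack4(PiC C)`;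
* **`J_four_ge_inventory`** — with part 0 (`J_four_ge_sum_slack_sub`):
  `slack4(P₀) + Σ_{C ∈ classes} slack4(PiC C) − (6/5)·X ≤ J₄(G)` — mine-2's §21.18.7 `Jlow′(π) ≥ T⁺(g,p) + Σ_j [T⁺(g,
  n + s_j) − …]` before the per-plane bounds and the covering count `X̄′` are substituted.

Still needed for Lemma TW: the per-plane bounds `slack4(P₀) ≥ T⁺(g,p)`, `slack4(PiC C) ≥ T⁺(g, n + s_C)` (from
`slack4_ge_of_mu` with the trace sizes `|PiC C ∩ G| = n + |C|`, `Pi_inter_G_eq`), and Lemma X̄′: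
`X ≤ 2[Σ_C 2^{|C|} + 2^{n+e}·[a covering pair] + 4n·#classes]` (the covering pairs of a plane-line solid, from
`Xcnt_le_sum_covPairs`).
-/

namespace PercRepro.SixFour

open Finset ThmH

variable {α : Type*} [DecidableEq α] {M : Matroid α} [M.Finite] {G : Finset α}

/-- **The per-pair inequality for every admissible `(p, m)` at every `g ≥ 10`** (p3's table `10 ≤ g ≤ 100` and
tail `g ≥ 101`). -/
theorem perPair4_all {g : ℕ} (hg : 10 ≤ g) :
    ∀ p m, 3 ≤ p → p + 3 ≤ g → 2 ≤ m → m < p → PerPair4 g p m := by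
  intro p m hp hpg hm hmp
  rcases Nat.lt_or_ge g 101 with h | h
  · exact perPair4_of_range hg (by omega) hp hpg hm hmp
  · exact perPair4_tail_forall g h p m hp hpg hm hmp

/-- **Nonnegative slack on every rank-`3` plane trace of `≤ g − 3` points** (`g ≥ 10`). -/
theorem slack4_nonneg (hs : Simple M) (hG : G ⊆ gr M) (hg : 10 ≤ G.card) {P : Finset α}
    (hr : M.eRk ((P ∩ G : Finset α) : Set α) = 3) (hp : (P ∩ G).card + 3 ≤ G.card) :
    0 ≤ slack4 M G P := by
  have hp3 := three_le_card_of_eRk_eq_three hr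
  have h := cert_plane_of_perPair4 hs hG hr (fun m hm2 hmp => perPair4_all hg _ _ hp3 hp hm2 hmp)
  have hxi : (0 : ℚ) ≤ (xiCrude G.card (P ∩ G).card : ℚ) := by positivity
  have hl : (0 : ℚ) ≤ (lppCredit M G P : ℚ) := by positivity
  unfold slack4
  linarith

namespace PLData

variable (D : PLData M G)

/-- The plane of a class: `PiC C = cl(L ∪ C)`. -/
noncomputable def PiC (C : Finset α) : Finset α := clF M (D.L ∪ C)

variable {D}

/-- `L` has at least `3` points when the trace of `P₀` has `≤ g − 3` points. -/
theorem three_le_card_L' (hpl : (D.P₀ ∩ G).card + 3 ≤ G.card) : 3 ≤ D.L.card := by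
  have := D.card_ρ_add_card_L
  unfold ρ at this
  omega

/-- The plane of the class of `y` is `Π_y`. -/
theorem PiC_eq_Pi (hs : Simple M) (hG : G ⊆ gr M) (h2 : 2 ≤ D.L.card) {y : α} (hy : y ∈ D.ρ)
    (hyℓ : y ∉ D.ellF) : D.PiC (D.lam y) = D.Pi y := by
  have hyG : y ∈ G := D.ρ_subset hy
  have hPi := Pi_mem_planes hs hG h2 hyG hyℓ
  -- `L ∪ λ_y ⊆ Π_y` and it contains `insert y L`, of rank `3`
  have hsub : D.L ∪ D.lam y ⊆ D.Pi y := by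
    intro z hz
    rcases Finset.mem_union.1 hz with hz | hz
    · exact hPi.2 (Finset.mem_insert_of_mem hz)
    · exact (Finset.mem_inter.1 hz).1
  have hsub' : insert y D.L ⊆ D.L ∪ D.lam y := by
    intro z hz
    rcases Finset.mem_insert.1 hz with rfl | hz
    · exact Finset.mem_union_right _ (mem_lam_self hs hG h2 hy hyℓ)
    · exact Finset.mem_union_left _ hz
  have hr3 : M.eRk ((D.L ∪ D.lam y : Finset α) : Set α) = 3 := by
    apply le_antisymm
    · have := M.eRk_mono (Finset.coe_subset.2 hsub)
      rwa [(mem_planes.1 hPi.1).2.2] at this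
    · have := M.eRk_mono (Finset.coe_subset.2 hsub')
      rwa [eRk_insert_L_eq_three hs hG h2 hyG hyℓ] at this
  unfold PiC
  apply Finset.coe_injective
  rw [coe_clF]
  exact closure_eq_of_subset_plane hPi.1 hsub hr3

/-- Every class is the class of one of its points outside `ℓ`. -/
theorem exists_eq_lam {C : Finset α} (hC : C ∈ D.classes) :
    ∃ y ∈ D.ρ, y ∉ D.ellF ∧ C = D.lam y := by
  unfold classes at hC
  obtain ⟨y, hy, rfl⟩ := Finset.mem_image.1 hC
  rw [Finset.mem_sdiff] at hy
  exact ⟨y, hy.1, hy.2, rfl⟩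

/-- The plane of a class is a plane of `M` with a rank-`3` trace, containing `L ∪ C`. -/
theorem PiC_facts (hs : Simple M) (hG : G ⊆ gr M) (h2 : 2 ≤ D.L.card) {C : Finset α}
    (hC : C ∈ D.classes) :
    D.PiC C ∈ planes M ∧ M.eRk ((D.PiC C ∩ G : Finset α) : Set α) = 3 ∧ D.L ∪ C ⊆ D.PiC C := by
  obtain ⟨y, hy, hyℓ, rfl⟩ := exists_eq_lam hC
  have hyG : y ∈ G := D.ρ_subset hy
  rw [PiC_eq_Pi hs hG h2 hy hyℓ]
  have hPi := Pi_mem_planes hs hG h2 hyG hyℓ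
  refine ⟨hPi.1, ?_, ?_⟩
  · apply le_antisymm (eRk_inter_plane_le_three hPi.1 G)
    have hsub : insert y D.L ⊆ D.Pi y ∩ G := by
      intro z hz
      rw [Finset.mem_inter]
      refine ⟨hPi.2 hz, ?_⟩
      rcases Finset.mem_insert.1 hz with rfl | hz
      · exact hyG
      · exact D.L_subset hz
    have := M.eRk_mono (Finset.coe_subset.2 hsub)
    rwa [eRk_insert_L_eq_three hs hG h2 hyG hyℓ] at this
  · intro z hz
    rcases Finset.mem_union.1 hz with hz | hz
    · exact hPi.2 (Finset.mem_insert_of_mem hz)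
    · exact (Finset.mem_inter.1 hz).1

/-- The plane of a class is not `P₀`. -/
theorem PiC_ne_P₀ (hs : Simple M) (hG : G ⊆ gr M) (h2 : 2 ≤ D.L.card) {C : Finset α}
    (hC : C ∈ D.classes) : D.PiC C ≠ D.P₀ := by
  obtain ⟨y, hy, hyℓ, rfl⟩ := exists_eq_lam hC
  rw [PiC_eq_Pi hs hG h2 hy hyℓ]
  exact Pi_ne_P₀ hs hG h2 (D.ρ_subset hy) hyℓ

/-- A class is the trace of its plane on `ρ`: `C = PiC C ∩ ρ`. -/
theorem PiC_inter_ρ (hs : Simple M) (hG : G ⊆ gr M) (h2 : 2 ≤ D.L.card) {C : Finset α}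
    (hC : C ∈ D.classes) : D.PiC C ∩ D.ρ = C := by
  obtain ⟨y, hy, hyℓ, rfl⟩ := exists_eq_lam hC
  rw [PiC_eq_Pi hs hG h2 hy hyℓ]
  rfl

/-- `C ↦ PiC C` is injective on the classes. -/
theorem PiC_injOn (hs : Simple M) (hG : G ⊆ gr M) (h2 : 2 ≤ D.L.card) :
    Set.InjOn D.PiC (D.classes : Set (Finset α)) := by
  intro C hC C' hC' heq
  rw [← PiC_inter_ρ hs hG h2 hC, ← PiC_inter_ρ hs hG h2 hC', heq]

/-- The trace of the plane of a class is `L ∪ C`. -/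
theorem PiC_inter_G (hs : Simple M) (hG : G ⊆ gr M) (h2 : 2 ≤ D.L.card) {C : Finset α}
    (hC : C ∈ D.classes) : D.PiC C ∩ G = D.L ∪ C := by
  obtain ⟨y, hy, hyℓ, rfl⟩ := exists_eq_lam hC
  rw [PiC_eq_Pi hs hG h2 hy hyℓ]
  exact D.Pi_inter_G_eq hs hG h2 y

/-- The trace of the plane of a class has `n + |C|` points (`L` and `C ⊆ ρ` are disjoint). -/
theorem card_PiC_inter_G (hs : Simple M) (hG : G ⊆ gr M) (h2 : 2 ≤ D.L.card) {C : Finset α}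
    (hC : C ∈ D.classes) : (D.PiC C ∩ G).card = D.L.card + C.card := by
  rw [PiC_inter_G hs hG h2 hC]
  apply Finset.card_union_of_disjoint
  rw [Finset.disjoint_left]
  intro z hzL hzC
  have hzρ : z ∈ D.ρ := (classes_facts hC hs hG h2).1 hzC
  unfold L at hzL
  unfold ρ at hzρ
  exact (Finset.mem_sdiff.1 hzL).2 (Finset.mem_inter.1 hzρ).1

/-- **The inventory bound**: the slacks of the other planes are nonnegative, so the sum over all rank-`3` plane
traces is at least the slack of `P₀` plus the slacks of the class planes. -/
theorem sum_slack4_ge_inventory (hs : Simple M) (hG : G ⊆ gr M)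
    (hpl : ∀ P ∈ planes M, (P ∩ G).card + 3 ≤ G.card) (hg : 10 ≤ G.card) :
    slack4 M G D.P₀ + ∑ C ∈ D.classes, slack4 M G (D.PiC C) ≤
      ∑ P ∈ (planes M).filter (fun P : Finset α => M.eRk ((P ∩ G : Finset α) : Set α) = 3), slack4 M G P := by
  have h2 : 2 ≤ D.L.card := by have := three_le_card_L' (D := D) (hpl _ D.plane); omega
  set S := (planes M).filter (fun P : Finset α => M.eRk ((P ∩ G : Finset α) : Set α) = 3) with hS
  set T := insert D.P₀ (D.classes.image D.PiC) with hT
  have hTS : T ⊆ S := by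
    intro P hP
    rw [hT, Finset.mem_insert, Finset.mem_image] at hP
    rw [hS, Finset.mem_filter]
    rcases hP with rfl | ⟨C, hC, rfl⟩
    · exact ⟨D.plane, D.rank_trace⟩
    · have := PiC_facts hs hG h2 hC
      exact ⟨this.1, this.2.1⟩
  have hnonneg : ∀ P ∈ S, P ∉ T → 0 ≤ slack4 M G P := by
    intro P hP _
    rw [hS, Finset.mem_filter] at hP
    exact slack4_nonneg hs hG hg hP.2 (hpl P hP.1)
  have hsub := Finset.sum_le_sum_of_subset_of_nonneg hTS hnonneg (f := slack4 M G)
  have hnot : D.P₀ ∉ D.classes.image D.PiC := by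
    rw [Finset.mem_image]
    rintro ⟨C, hC, h⟩
    exact PiC_ne_P₀ hs hG h2 hC h
  rw [hT, Finset.sum_insert hnot, Finset.sum_image (PiC_injOn hs hG h2)] at hsub
  exact hsub

/-- **`J₄` from the inventory**: `slack4(P₀) + Σ_{C ∈ classes} slack4(PiC C) − (6/5)·X ≤ J₄(G)`. -/
theorem J_four_ge_inventory (hs : Simple M) (hG : G ⊆ gr M) (hr : M.eRk (G : Set α) = 4)
    (hpl : ∀ P ∈ planes M, (P ∩ G).card + 3 ≤ G.card) (hg : 10 ≤ G.card) :
    slack4 M G D.P₀ + ∑ C ∈ D.classes, slack4 M G (D.PiC C) - 6 / 5 * (Xcnt M G : ℚ) ≤ J M G 4 := by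
  have h1 := sum_slack4_ge_inventory (D := D) hs hG hpl hg
  have h2 := J_four_ge_sum_slack_sub hs hG hr (by omega)
  linarith

end PLData

end PercRepro.SixFour
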